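import Literature.AlgebraicGeometry.HodgeTheory.VHSDataMorphismsFromOneFibre
import Literature.AlgebraicGeometry.HodgeTheory.VHSDataHodgeGenericPointsRetracts
import Literature.AlgebraicGeometry.Motives.HodgeStructureStrictProofs
import HarnessLib

/-!
# Extension of morphisms and isomorphisms of VHS data from a HODGE-GENERIC point of `D₁ ⊕ D₂`: `Hom(D₁, D₂)` is a retract of `End(D₁ ⊕ D₂)`, so at a
# point Hodge-generic for `D₁ ⊕ D₂` a monodromy-equivariant lattice map `V₁,ℤ,s → V₂,ℤ,s` which is a morphism of the Hodge structures at `s` extends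
# uniquely to a morphism `D₁ → D₂`; a morphism bijective on one lattice is an isomorphism (strictness), hence isomorphisms extend as well

Topic `Literature/AlgebraicGeometry/HodgeTheory` (namespace `Literature.AlgebraicGeometry.Motives.VHSData`), lane `lit-hodgefound` (seat `p08`, row g61-#15);
sequel of `VHSDataMorphismsFromOneFibre` (`exists_hom_app_eq_iff`: extension iff monodromy-equivariant and `[f]` generic), `VHSDataHodgeGenericPointsRetracts`
(`exceptionalHodgeLocus_subset_of_comp_eq_id`: exceptional loci grow along retracts), `VHSDataHodgeClassesAlongPathsTensorConstructions`
(`hodgeGenericLocus_subset_compl_exceptionalHodgeLocus_hom`: `End(D) ≅ T^{1,1}D`) over the tree's `Hom(φ, ψ)` (`Motives/FamiliesVHSTensorMorphism`: `Hom.homMap`,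
`Hom.homMap_app`), the biproduct morphisms (`Motives/FamiliesVHSProdMorphism`: `Hom.fst_comp_inl`, `Hom.snd_comp_inr`), isomorphisms (`Motives/FamiliesVHSIso`)
and STRICTNESS of morphisms of Hodge structures (`Motives/HodgeStructureStrictProofs`: `HodgeStructure.Hom.strict_holds`, Deligne Hodge II 2.3.5).  THEOREMS ONLY —
no definition, no named fact, no instance (D-0026 net debt `0`).

PRINTED SOURCES.  P. Deligne, LNM 163 (1970), I.1, Cor. 1.4 (`Hom(V₁, V₂) = Hom_{π₁}(V₁,x₀, V₂,x₀)` on a connected base); P. Deligne, *Théorie de Hodge II*,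
Thm. 2.3.5 (morphisms of Hodge structures are strict; a bijective morphism is an isomorphism), 2.1 (biproducts); C. Voisin, *Hodge Theory I*, §7.3.1 and
Lemma 7.25 (morphisms of VHS; Hodge classes of `Hom`); M. Green, P. Griffiths, M. Kerr (2012), Ch. III (III.2) (at a generic point the Hodge tensors are
invariant under continuation — here for `End(V₁ ⊕ V₂) ⊇ Hom(V₁, V₂)`).

CONTENT.
* §1 `Hom(−, −)` IS A BIFUNCTOR: `Hom.homMap_comp`, `Hom.homMap_id`; **`homMap_inl_snd_comp_homMap_fst_inr`** (`Hom(D₁, D₂)` is a RETRACT of `End(D₁ ⊕ D₂)`: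
  `f ↦ ι₂ ∘ f ∘ pr₁`, `g ↦ pr₂ ∘ g ∘ ι₁`).
* §2 **`exceptionalHodgeLocus_hom_subset_hom_prod`**, **`hodgeGenericLocus_prod_subset_compl_exceptionalHodgeLocus_hom`** (a point Hodge-generic for `D₁ ⊕ D₂`
  is outside the exceptional locus of `Hom(D₁, D₂)` in level `0`), `isHodgeAlong_univ_hom_of_mem_hodgeGenericLocus_prod`.
* §3 EXTENSION OF MORPHISMS: **`exists_hom_app_eq_iff_of_mem_hodgeGenericLocus_prod`** (path-connected base, `s` Hodge-generic for `D₁ ⊕ D₂`: `f` extends iff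
  monodromy-equivariant and `[f]` of type `(0,0)` at `s`), filtration form, uniqueness, and the simply connected forms
  **`exists_hom_app_eq_iff_isHodgeAt_of_mem_hodgeGenericLocus_prod_of_simplyConnected`** (EVERY morphism of Hodge structures `V₁,s → V₂,s` preserving the
  lattices extends uniquely).
* §4 ISOMORPHISMS: `Hom.bijective_app_of_bijective_app` (bijectivity propagates along paths), **`Hom.exists_iso_of_forall_bijective`** (A MORPHISM OF VHS DATA
  BIJECTIVE ON THE LATTICES IS AN ISOMORPHISM — the inverse respects the Hodge filtrations by STRICTNESS), `Hom.exists_iso_of_bijective_app` (path-connected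
  base: bijective at one point suffices), **`exists_iso_hom_app_eq_iff_of_mem_hodgeGenericLocus_prod`** (at a point Hodge-generic for `D₁ ⊕ D₂`: an
  equivariant lattice ISOMORPHISM which is a morphism of Hodge structures at `s` extends uniquely to an ISOMORPHISM `D₁ ≅ D₂`), and its simply connected form.

HONEST SCOPE.  Integral morphisms on the hypothesis structure `VHSData`; no holomorphy; the Hodge-genericity hypothesis refers to `D₁ ⊕ D₂` (not to `D₁`,
`D₂` separately, which would not suffice).

## References

* [Deligne1970] P. Deligne, *Équations différentielles à points singuliers réguliers*, LNM 163 (1970), I.1, Prop. 1.3 and Cor. 1.4.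
* [DeligneHodgeII1971] P. Deligne, *Théorie de Hodge II*, Publ. Math. IHÉS 40 (1971), 1.1.6, 2.1, Thm. 2.3.5.
* [VoisinHodgeI2002] C. Voisin, *Hodge Theory and Complex Algebraic Geometry I*, CUP (2002), §7.3.1, Lemma 7.25.
* [GreenGriffithsKerr2012] M. Green, P. Griffiths, M. Kerr, *Mumford–Tate Groups and Domains*, Ann. of Math. Studies 183 (2012), Ch. III, (III.2).
* [BourbakiAlgebraI1989] N. Bourbaki, *Algebra I*, Springer (1989), Ch. II §4 no. 2 (`Hom(u, v) = ᵗu ⊗ v`).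
* [Schmid1973] W. Schmid, *Variation of Hodge structure: the singularities of the period mapping*, Invent. Math. 22 (1973), §2.
-/

noncomputable section

open _root_.Topology _root_.Filter Set

namespace Literature.AlgebraicGeometry

open Motives Motives.HodgeStructure HodgeTheory Topology

namespace Motives.VHSData

variable {S : Type} [TopologicalSpace S] {k k₁ k₂ : ℤ}

/-! ## §1 `Hom(−, −)` is a bifunctor; `Hom(D₁, D₂)` is a retract of `End(D₁ ⊕ D₂)` -/

section HomMap

variable {D₁ D₁' D₁'' : VHSData S k₁} {D₂ D₂' D₂'' : VHSData S k₂}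

/-- **Functoriality of `Hom(φ, ψ)`**: `Hom(φ₂, ψ₂) ∘ Hom(φ₁, ψ₁) = Hom(φ₁ ∘ φ₂, ψ₂ ∘ ψ₁)` (`ᵗ(φ₁φ₂) ⊗ ψ₂ψ₁ = (ᵗφ₂ ⊗ ψ₂)(ᵗφ₁ ⊗ ψ₁)`).
[cite: Deligne1970, I.1] [cite: BourbakiAlgebraI1989, Ch. II §4 no. 2] -/
theorem Hom.homMap_comp (φ₂ : Hom D₁'' D₁') (φ₁ : Hom D₁' D₁) (ψ₁ : Hom D₂ D₂') (ψ₂ : Hom D₂' D₂'') :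
    (Hom.homMap φ₂ ψ₂).comp (Hom.homMap φ₁ ψ₁) = Hom.homMap (φ₁.comp φ₂) (ψ₂.comp ψ₁) :=
  Hom.ext_of_app _ _ fun s => by
    simp only [Hom.comp_app, Hom.homMap_app]
    rw [← LinearMap.dualMap_comp_dualMap, TensorProduct.map_comp]
    rfl

/-- `Hom(id, id) = id`. [cite: Deligne1970, I.1] [cite: BourbakiAlgebraI1989, Ch. II §4 no. 2] -/
theorem Hom.homMap_id (D₁ : VHSData S k₁) (D₂ : VHSData S k₂) : Hom.homMap (Hom.id D₁) (Hom.id D₂) = Hom.id (D₁.hom D₂) :=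
  Hom.ext_of_app _ _ fun s => by
    simp only [Hom.homMap_app, Hom.id_app, LinearMap.dualMap_id, TensorProduct.map_id]
    rfl

end HomMap

section Retract

variable (D₁ D₂ : VHSData S k)

/-- **`Hom(D₁, D₂)` IS A RETRACT OF `End(D₁ ⊕ D₂)`**: `Hom(ι₁, pr₂) ∘ Hom(pr₁, ι₂) = Hom(pr₁ ι₁, pr₂ ι₂) = id` (`f ↦ ι₂ f pr₁ ↦ pr₂ ι₂ f pr₁ ι₁ = f`).
[cite: DeligneHodgeII1971, 2.1] [cite: BourbakiAlgebraI1989, Ch. II §4 no. 2] -/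
theorem homMap_inl_snd_comp_homMap_fst_inr :
    (Hom.homMap (Hom.inl D₁ D₂) (Hom.snd D₁ D₂)).comp (Hom.homMap (Hom.fst D₁ D₂) (Hom.inr D₁ D₂)) = Hom.id (D₁.hom D₂) := by
  rw [Hom.homMap_comp, Hom.fst_comp_inl, Hom.snd_comp_inr, Hom.homMap_id]

/-! ## §2 A point Hodge-generic for `D₁ ⊕ D₂` is generic for `Hom(D₁, D₂)` -/

/-- **The exceptional loci of `Hom(D₁, D₂)` lie in those of `End(D₁ ⊕ D₂)`** (retract). [cite: VoisinHodgeI2002, §7.3.1 and Lemma 7.25] [cite: DeligneHodgeII1971, 2.1] -/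
theorem exceptionalHodgeLocus_hom_subset_hom_prod (p : ℤ) :
    (D₁.hom D₂).exceptionalHodgeLocus p ⊆ ((D₁.prod D₂).hom (D₁.prod D₂)).exceptionalHodgeLocus p :=
  exceptionalHodgeLocus_subset_of_comp_eq_id (homMap_inl_snd_comp_homMap_fst_inr D₁ D₂) p

/-- **A POINT HODGE-GENERIC FOR `D₁ ⊕ D₂` IS OUTSIDE THE EXCEPTIONAL LOCUS OF `Hom(D₁, D₂)` IN LEVEL `0`** (`End(D₁ ⊕ D₂) ≅ T^{1,1}(D₁ ⊕ D₂)`).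
[cite: GreenGriffithsKerr2012, Ch. III (III.2)] [cite: VoisinHodgeI2002, Lemma 7.25] -/
theorem hodgeGenericLocus_prod_subset_compl_exceptionalHodgeLocus_hom : (D₁.prod D₂).hodgeGenericLocus ⊆ ((D₁.hom D₂).exceptionalHodgeLocus 0)ᶜ :=
  fun _ hs hmem => hodgeGenericLocus_subset_compl_exceptionalHodgeLocus_hom hs (D₁.exceptionalHodgeLocus_hom_subset_hom_prod D₂ 0 hmem)

variable {D₁ D₂}

/-- **At a point Hodge-generic for `D₁ ⊕ D₂` every integral class of `Hom(D₁, D₂)` of type `(0,0)` is generic.** [cite: GreenGriffithsKerr2012, Ch. III (III.2)]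
[cite: VoisinHodgeI2002, Lemma 7.25] -/
theorem isHodgeAlong_univ_hom_of_mem_hodgeGenericLocus_prod {s : S} (hs : s ∈ (D₁.prod D₂).hodgeGenericLocus) {z : (D₁.hom D₂).VZ.fiber s}
    (hz : (D₁.hom D₂).IsHodgeAt s 0 z) : (D₁.hom D₂).IsHodgeAlong 0 z univ := by
  by_contra hnot
  exact D₁.hodgeGenericLocus_prod_subset_compl_exceptionalHodgeLocus_hom D₂ hs ⟨z, hz, hnot⟩

end Retract

/-! ## §3 Extension of morphisms at a point Hodge-generic for `D₁ ⊕ D₂` -/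

section Extension

variable (D₁ D₂ : VHSData S k) {s : S}

/-- **EXTENSION OF MORPHISMS AT A HODGE-GENERIC POINT OF `D₁ ⊕ D₂`** (path-connected base): a lattice map `f : V₁,ℤ,s → V₂,ℤ,s` is `φ_s` for a morphism
`φ : D₁ → D₂` iff it commutes with the monodromy of the loops at `s` and its class `[f] ∈ Hom(D₁, D₂)_s` is of type `(0,0)` AT `s`.
[cite: Deligne1970, I.1, Cor. 1.4] [cite: GreenGriffithsKerr2012, Ch. III (III.2)] [cite: VoisinHodgeI2002, §7.3.1 and Lemma 7.25] -/
theorem exists_hom_app_eq_iff_of_mem_hodgeGenericLocus_prod [PathConnectedSpace S] (hs : s ∈ (D₁.prod D₂).hodgeGenericLocus)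
    (f : D₁.VZ.fiber s →ₗ[ℤ] D₂.VZ.fiber s) :
    (∃ φ : Hom D₁ D₂, φ.app s = f) ↔
      (∀ γ : Path.Homotopic.Quotient s s, f ∘ₗ D₁.VZ.transport γ = D₂.VZ.transport γ ∘ₗ f) ∧ (D₁.hom D₂).IsHodgeAt s 0 (D₁.homClass D₂ s f) := by
  rw [exists_hom_app_eq_iff]
  exact and_congr_right fun _ => ⟨fun h => h.isHodgeAt (mem_univ s), fun h => isHodgeAlong_univ_hom_of_mem_hodgeGenericLocus_prod hs h⟩

/-- Filtration form: `f` extends iff it commutes with the monodromy and `f_ℚ` respects the Hodge filtrations at `s`.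
[cite: Deligne1970, I.1, Cor. 1.4] [cite: VoisinHodgeI2002, §7.3.1 and Lemma 7.25] -/
theorem exists_hom_app_eq_iff_forall_map_F_le_of_mem_hodgeGenericLocus_prod [PathConnectedSpace S] (hs : s ∈ (D₁.prod D₂).hodgeGenericLocus)
    (f : D₁.VZ.fiber s →ₗ[ℤ] D₂.VZ.fiber s) :
    (∃ φ : Hom D₁ D₂, φ.app s = f) ↔
      (∀ γ : Path.Homotopic.Quotient s s, f ∘ₗ D₁.VZ.transport γ = D₂.VZ.transport γ ∘ₗ f) ∧
        ∀ p : ℤ, ((D₁.hodge s).F p).map ((D₁.homRat D₂ s f).baseChange ℂ) ≤ (D₂.hodge s).F p := by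
  rw [D₁.exists_hom_app_eq_iff_of_mem_hodgeGenericLocus_prod D₂ hs, isHodgeAt_homClass_iff]

/-- Uniqueness included (rigidity). [cite: Deligne1970, I.1, Cor. 1.4] [cite: Schmid1973, §2] -/
theorem existsUnique_hom_app_eq_of_mem_hodgeGenericLocus_prod [PathConnectedSpace S] (hs : s ∈ (D₁.prod D₂).hodgeGenericLocus)
    {f : D₁.VZ.fiber s →ₗ[ℤ] D₂.VZ.fiber s} (hequiv : ∀ γ : Path.Homotopic.Quotient s s, f ∘ₗ D₁.VZ.transport γ = D₂.VZ.transport γ ∘ₗ f)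
    (hf : (D₁.hom D₂).IsHodgeAt s 0 (D₁.homClass D₂ s f)) : ∃! φ : Hom D₁ D₂, φ.app s = f := by
  obtain ⟨φ, hφ⟩ := (D₁.exists_hom_app_eq_iff_of_mem_hodgeGenericLocus_prod D₂ hs f).2 ⟨hequiv, hf⟩
  exact ⟨φ, hφ, fun ψ hψ => Hom.ext_of_app_eq ψ φ s (hψ.trans hφ.symm)⟩

/-- **SIMPLY CONNECTED BASE: AT A POINT HODGE-GENERIC FOR `D₁ ⊕ D₂`, EVERY lattice map whose class is of type `(0,0)` — i.e. every morphism of the Hodge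
structures `V₁,s → V₂,s` preserving the lattices — EXTENDS to a morphism `D₁ → D₂`.** [cite: Deligne1970, I.1, Cor. 1.4] [cite: GreenGriffithsKerr2012, Ch. III (III.2)]
[cite: VoisinHodgeI2002, Lemma 7.25] -/
theorem exists_hom_app_eq_iff_isHodgeAt_of_mem_hodgeGenericLocus_prod_of_simplyConnected [SimplyConnectedSpace S] (hs : s ∈ (D₁.prod D₂).hodgeGenericLocus)
    (f : D₁.VZ.fiber s →ₗ[ℤ] D₂.VZ.fiber s) : (∃ φ : Hom D₁ D₂, φ.app s = f) ↔ (D₁.hom D₂).IsHodgeAt s 0 (D₁.homClass D₂ s f) := by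
  rw [exists_hom_app_eq_iff_isHodgeAlong_of_simplyConnected]
  exact ⟨fun h => h.isHodgeAt (mem_univ s), fun h => isHodgeAlong_univ_hom_of_mem_hodgeGenericLocus_prod hs h⟩

/-- The same with the Hodge filtrations. [cite: VoisinHodgeI2002, §7.3.1 and Lemma 7.25] -/
theorem exists_hom_app_eq_iff_forall_map_F_le_of_mem_hodgeGenericLocus_prod_of_simplyConnected [SimplyConnectedSpace S]
    (hs : s ∈ (D₁.prod D₂).hodgeGenericLocus) (f : D₁.VZ.fiber s →ₗ[ℤ] D₂.VZ.fiber s) :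
    (∃ φ : Hom D₁ D₂, φ.app s = f) ↔ ∀ p : ℤ, ((D₁.hodge s).F p).map ((D₁.homRat D₂ s f).baseChange ℂ) ≤ (D₂.hodge s).F p := by
  rw [D₁.exists_hom_app_eq_iff_isHodgeAt_of_mem_hodgeGenericLocus_prod_of_simplyConnected D₂ hs, isHodgeAt_homClass_iff]

end Extension

/-! ## §4 Bijective morphisms are isomorphisms (strictness); extension of isomorphisms -/

section Isomorphisms

variable {D₁ D₂ : VHSData S k}

/-- Bijectivity of the lattice maps of a morphism propagates along paths (`φ_t = γ_* φ_s γ⁻¹_*`). [cite: Deligne1970, I.1] -/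
theorem Hom.bijective_app_of_bijective_app (φ : Hom D₁ D₂) {s t : S} (γ : Path.Homotopic.Quotient s t) (h : Function.Bijective (φ.app s)) :
    Function.Bijective (φ.app t) := by
  rw [← φ.transport_comp_app_comp_transport_symm γ, LinearMap.coe_comp, LinearMap.coe_comp]
  have h₂ : Function.Bijective (D₂.VZ.transport γ) := by
    rw [← LocalSystem.coe_transportEquiv]
    exact (D₂.VZ.transportEquiv γ).bijective
  have h₁ : Function.Bijective (D₁.VZ.transport γ.symm) := by
    rw [← LocalSystem.coe_transportEquiv]
    exact (D₁.VZ.transportEquiv γ.symm).bijective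
  exact h₂.comp (h.comp h₁)

/-- **A MORPHISM OF VHS DATA WHICH IS BIJECTIVE ON EVERY LATTICE IS AN ISOMORPHISM**: the inverse lattice maps are flat, and respect the Hodge filtrations
because morphisms of Hodge structures are STRICT (`φ(F^p V₁) = F^p V₂ ∩ im φ = F^p V₂`). [cite: DeligneHodgeII1971, Thm. 2.3.5] [cite: VoisinHodgeI2002, §7.3.1] -/
theorem Hom.exists_iso_of_forall_bijective (φ : Hom D₁ D₂) (h : ∀ t : S, Function.Bijective (φ.app t)) : ∃ e : Iso D₁ D₂, e.hom = φ := by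
  -- the inverse lattice maps
  set g : ∀ t : S, D₂.VZ.fiber t →ₗ[ℤ] D₁.VZ.fiber t := fun t =>
    ((LinearEquiv.ofBijective (φ.app t) (h t)).symm : D₂.VZ.fiber t →ₗ[ℤ] D₁.VZ.fiber t) with hg
  have hgφ : ∀ (t : S) (u : D₁.VZ.fiber t), g t (φ.app t u) = u := fun t u =>
    (LinearEquiv.ofBijective (φ.app t) (h t)).symm_apply_apply u
  have hφg : ∀ (t : S) (v : D₂.VZ.fiber t), φ.app t (g t v) = v := fun t v =>
    (LinearEquiv.ofBijective (φ.app t) (h t)).apply_symm_apply v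
  -- flatness of the inverses
  have hflat : ∀ {s t : S} (γ : Path.Homotopic.Quotient s t) (v : D₂.VZ.fiber s), g t (D₂.VZ.transport γ v) = D₁.VZ.transport γ (g s v) := by
    intro s t γ v
    apply (h t).1
    rw [hφg, φ.app_transport, hφg]
  -- the rationalizations are mutually inverse
  have hcomp₁ : ∀ t : S, D₂.homRat D₁ t (g t) ∘ₗ D₁.homRat D₂ t (φ.app t) = LinearMap.id := fun t => by
    rw [← homRat_comp, show g t ∘ₗ φ.app t = LinearMap.id from LinearMap.ext (hgφ t), homRat_id]
  have hcomp₂ : ∀ t : S, D₁.homRat D₂ t (φ.app t) ∘ₗ D₂.homRat D₁ t (g t) = LinearMap.id := fun t => by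
    rw [← homRat_comp, show φ.app t ∘ₗ g t = LinearMap.id from LinearMap.ext (hφg t), homRat_id]
  -- the inverses respect the Hodge filtrations: strictness of `φ_t`
  have hH : ∀ (t : S) (p : ℤ), ((D₂.hodge t).F p).map ((D₂.homRat D₁ t (g t)).baseChange ℂ) ≤ (D₁.hodge t).F p := by
    intro t p
    have hstrict := HodgeStructure.Hom.strict_holds (φ.hodgeHom t) p
    have hrange : LinearMap.range ((D₁.homRat D₂ t (φ.app t)).baseChange ℂ) = ⊤ := by
      refine LinearMap.range_eq_top.2 fun y => ⟨(D₂.homRat D₁ t (g t)).baseChange ℂ y, ?_⟩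
      rw [← LinearMap.comp_apply, ← LinearMap.baseChange_comp, hcomp₂ t, LinearMap.baseChange_id, LinearMap.id_apply]
    have hF : (D₂.hodge t).F p = ((D₁.hodge t).F p).map ((D₁.homRat D₂ t (φ.app t)).baseChange ℂ) := by
      change (D₂.hodge t).F p = ((D₁.hodge t).F p).map ((φ.hodgeHom t).toLinearMap.baseChange ℂ)
      rw [hstrict]
      change (D₂.hodge t).F p = (D₂.hodge t).F p ⊓ LinearMap.range ((D₁.homRat D₂ t (φ.app t)).baseChange ℂ)
      rw [hrange, inf_top_eq]
    rw [hF, ← Submodule.map_comp, ← LinearMap.baseChange_comp, hcomp₁ t, LinearMap.baseChange_id, Submodule.map_id]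
  refine ⟨⟨φ, Hom.ofFlat g hflat hH, Hom.ext_of_app _ _ fun t => LinearMap.ext fun u => ?_, Hom.ext_of_app _ _ fun t => LinearMap.ext fun v => ?_⟩, rfl⟩
  · exact hgφ t u
  · exact hφg t v

/-- **Path-connected base: a morphism bijective on ONE lattice is an isomorphism.** [cite: DeligneHodgeII1971, Thm. 2.3.5] [cite: Deligne1970, I.1] -/
theorem Hom.exists_iso_of_bijective_app [PathConnectedSpace S] (φ : Hom D₁ D₂) (s : S) (h : Function.Bijective (φ.app s)) : ∃ e : Iso D₁ D₂, e.hom = φ :=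
  φ.exists_iso_of_forall_bijective fun t => φ.bijective_app_of_bijective_app (Path.Homotopic.Quotient.mk (PathConnectedSpace.somePath s t)) h

variable (D₁ D₂)

/-- **EXTENSION OF ISOMORPHISMS AT A HODGE-GENERIC POINT OF `D₁ ⊕ D₂`** (path-connected base): a lattice map `f : V₁,ℤ,s → V₂,ℤ,s` is `e_s` for an
ISOMORPHISM `e : D₁ ≅ D₂` iff `f` is bijective, commutes with the monodromy, and `[f]` is of type `(0,0)` at `s`.
[cite: Deligne1970, I.1, Cor. 1.4] [cite: DeligneHodgeII1971, Thm. 2.3.5] [cite: GreenGriffithsKerr2012, Ch. III (III.2)] -/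
theorem exists_iso_hom_app_eq_iff_of_mem_hodgeGenericLocus_prod [PathConnectedSpace S] {s : S} (hs : s ∈ (D₁.prod D₂).hodgeGenericLocus)
    (f : D₁.VZ.fiber s →ₗ[ℤ] D₂.VZ.fiber s) :
    (∃ e : Iso D₁ D₂, e.hom.app s = f) ↔ Function.Bijective f ∧
      (∀ γ : Path.Homotopic.Quotient s s, f ∘ₗ D₁.VZ.transport γ = D₂.VZ.transport γ ∘ₗ f) ∧ (D₁.hom D₂).IsHodgeAt s 0 (D₁.homClass D₂ s f) := by
  constructor
  · rintro ⟨e, rfl⟩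
    exact ⟨e.hom_app_bijective s, e.hom.forall_comp_transport_and_isHodgeAlong s |>.1,
      (e.hom.forall_comp_transport_and_isHodgeAlong s).2.isHodgeAt (mem_univ s)⟩
  · rintro ⟨hbij, hequiv, hf⟩
    obtain ⟨φ, hφ⟩ := (D₁.exists_hom_app_eq_iff_of_mem_hodgeGenericLocus_prod D₂ hs f).2 ⟨hequiv, hf⟩
    obtain ⟨e, rfl⟩ := φ.exists_iso_of_bijective_app s (hφ ▸ hbij)
    exact ⟨e, hφ⟩

/-- **Simply connected base: at a point Hodge-generic for `D₁ ⊕ D₂` every ISOMORPHISM of the Hodge structures `V₁,s ⥲ V₂,s` identifying the lattices extends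
(uniquely) to an isomorphism `D₁ ≅ D₂`.** [cite: Deligne1970, I.1, Cor. 1.4] [cite: DeligneHodgeII1971, Thm. 2.3.5] [cite: GreenGriffithsKerr2012, Ch. III (III.2)] -/
theorem exists_iso_hom_app_eq_iff_of_mem_hodgeGenericLocus_prod_of_simplyConnected [SimplyConnectedSpace S] {s : S}
    (hs : s ∈ (D₁.prod D₂).hodgeGenericLocus) (f : D₁.VZ.fiber s →ₗ[ℤ] D₂.VZ.fiber s) :
    (∃ e : Iso D₁ D₂, e.hom.app s = f) ↔ Function.Bijective f ∧ (D₁.hom D₂).IsHodgeAt s 0 (D₁.homClass D₂ s f) := by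
  rw [D₁.exists_iso_hom_app_eq_iff_of_mem_hodgeGenericLocus_prod D₂ hs f]
  refine ⟨fun h => ⟨h.1, h.2.2⟩, fun h => ⟨h.1, fun γ => ?_, h.2⟩⟩
  rw [D₁.VZ.transport_loop_eq_id_of_simplyConnected γ, D₂.VZ.transport_loop_eq_id_of_simplyConnected γ, LinearMap.comp_id, LinearMap.id_comp]

end Isomorphisms

end Motives.VHSData

end Literature.AlgebraicGeometry

end
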